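import Mathlib
import HarnessLib
import Literature.MathematicalPhysics.QuantumLattice.ApproximateEigenvectorLemmas
import Literature.MathematicalPhysics.QuantumLattice.SectorSpectrum
import Summits.HubbardSuperconductivity.HubbardSuperconductivity.Theorems.WeakCouplingBCSWcbcsBcsConstructionTrialStateSectors

/-!
# Route `WeakCouplingBCS`, support item `WcbcsTowerTrialBudget` (stmt-HubbardSuperconductivity-1211):
# the abstract tower trial-state budget

Support file (`--supports stmt-HubbardSuperconductivity-1211`) for the closing file
`WeakCouplingBCSWcbcsTowerTrialBudget.lean`. Pure finite-dimensional matrix analysis, in the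
vocabulary of `WeakCouplingBCSWcbcsBcsConstructionTrialStateSectors` (whose selection-rule lemmas
are reused): Hermitian `H` (Hamiltonian), `N` (particle number), a quadratic-form minorant `H₀` of
`H`, a charge-`-2` operator `X` (`[N, X] = -2X`) and `O = X + Xᴴ`; inner product `⟨u, v⟩ = star u ⬝ᵥ v`,
operator norm the `L2Operator` norm.

* `mul_re_le_of_unit_bound`: a lower bound on unit vectors is a homogeneous lower bound.
* `charged_number_expect`: for an `N`-eigenvector `v`, `‖Ov‖² = ‖Xv‖² + ‖Xᴴv‖²` and
  `⟨Ov, N Ov⟩ = (a-2)‖Xv‖² + (a+2)‖Xᴴv‖²` (so `|⟨Ov, N Ov⟩ - a‖Ov‖²| ≤ 2‖Ov‖²`).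
* `trial_budget`: for a unit vector `Φ` with `HΦ = eΦ`, `NΦ = nΦ`, `q = ‖OΦ‖² > 0` and a lower
  bound `E` of `H₀ - μN - hO` on unit vectors,
  `h√q ≤ e + ‖[O,[O,H]]‖/(4q) - μn + |μ| - E` — the Koma–Tasaki trial state `Ξ = Φ + OΦ/√q`
  (T. Koma, H. Tasaki, J. Stat. Phys. 76 (1994) 745, proof of Theorem 2.2) for an EXACT eigenvector,
  where the cross terms vanish and only the double commutator `⟨Φ,[O,[O,H]]Φ⟩/(4q)` survives.

No definitions; everything is proved.
-/

-- the summit-side namespace `Summit.HubbardSuperconductivity.HubbardSuperconductivity` repeats a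
-- component by design (D-0017 nested layout), which the `dupNamespace` linter would flag:
set_option linter.dupNamespace false

namespace Summit.HubbardSuperconductivity.HubbardSuperconductivity.Theorems

open Literature.MathematicalPhysics.QuantumLattice Matrix
open scoped Matrix.Norms.L2Operator ComplexOrder

namespace WcbcsTowerTrial

open WcbcsTrialState

variable {m : Type*} [Fintype m]

/-- From a lower bound on unit vectors to the homogeneous bound `E ‖Ξ‖² ≤ Re ⟨Ξ, K Ξ⟩`
(normalise `Ξ ≠ 0`). [folklore] -/
theorem mul_re_le_of_unit_bound {K : Matrix m m ℂ} {E : ℝ}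
    (hE : ∀ φ : m → ℂ, star φ ⬝ᵥ φ = 1 → E ≤ (star φ ⬝ᵥ (K *ᵥ φ)).re) (Ξ : m → ℂ) :
    E * (star Ξ ⬝ᵥ Ξ).re ≤ (star Ξ ⬝ᵥ (K *ᵥ Ξ)).re := by
  by_cases h0 : Ξ = 0
  · subst h0
    simp
  obtain ⟨c, _, hc1⟩ := exists_smul_unit h0
  have h2 := hE _ hc1
  have hcc : star c * c = ((‖c‖ ^ 2 : ℝ) : ℂ) := by
    rw [Complex.star_def, Complex.conj_mul']
    push_cast
    rfl
  rw [mulVec_smul, star_smul, smul_dotProduct, dotProduct_smul, smul_smul, hcc, smul_eq_mul,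
    Complex.re_ofReal_mul] at h2
  rw [star_smul, smul_dotProduct, dotProduct_smul, smul_smul, hcc, smul_eq_mul] at hc1
  have h1 : ‖c‖ ^ 2 * (star Ξ ⬝ᵥ Ξ).re = 1 := by
    have := congrArg Complex.re hc1
    rwa [Complex.re_ofReal_mul, Complex.one_re] at this
  have hpos : 0 < ‖c‖ ^ 2 := by
    by_contra hle
    have : ‖c‖ ^ 2 = 0 := le_antisymm (not_lt.1 hle) (sq_nonneg _)
    rw [this, zero_mul] at h1
    exact zero_ne_one h1
  have key : ‖c‖ ^ 2 * (E * (star Ξ ⬝ᵥ Ξ).re) ≤ ‖c‖ ^ 2 * (star Ξ ⬝ᵥ (K *ᵥ Ξ)).re :=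
    calc ‖c‖ ^ 2 * (E * (star Ξ ⬝ᵥ Ξ).re) = E * (‖c‖ ^ 2 * (star Ξ ⬝ᵥ Ξ).re) := by ring
      _ = E := by rw [h1, mul_one]
      _ ≤ ‖c‖ ^ 2 * (star Ξ ⬝ᵥ (K *ᵥ Ξ)).re := h2
  exact le_of_mul_le_mul_left key hpos

/-- For an `N`-eigenvector `v` (`N v = a v`) and a charge-`-2` operator `X` (`[N, X] = -2X`):
`‖(X + Xᴴ) v‖² = ‖X v‖² + ‖Xᴴ v‖²` and `⟨(X+Xᴴ)v, N (X+Xᴴ) v⟩ = (a-2)‖Xv‖² + (a+2)‖Xᴴv‖²` — the two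
components `X v`, `Xᴴ v` carry the distinct charges `a ∓ 2` and are orthogonal. [folklore] -/
theorem charged_number_expect {N X : Matrix m m ℂ} (hN : N.IsHermitian)
    (hX : N * X - X * N = ((-2 : ℝ) : ℂ) • X) {v : m → ℂ} {a : ℝ}
    (hv : N *ᵥ v = (a : ℂ) • v) :
    star ((X + Xᴴ) *ᵥ v) ⬝ᵥ ((X + Xᴴ) *ᵥ v) =
        star (X *ᵥ v) ⬝ᵥ (X *ᵥ v) + star (Xᴴ *ᵥ v) ⬝ᵥ (Xᴴ *ᵥ v) ∧
      star ((X + Xᴴ) *ᵥ v) ⬝ᵥ (N *ᵥ ((X + Xᴴ) *ᵥ v)) =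
        ((a - 2 : ℝ) : ℂ) * (star (X *ᵥ v) ⬝ᵥ (X *ᵥ v)) +
          ((a + 2 : ℝ) : ℂ) * (star (Xᴴ *ᵥ v) ⬝ᵥ (Xᴴ *ᵥ v)) := by
  have hX' := commutator_conjTranspose_of_commutator hN hX
  have hm := eigen_mulVec_of_commutator hX hv
  have hp := eigen_mulVec_of_commutator hX' hv
  have h1 : star (X *ᵥ v) ⬝ᵥ (Xᴴ *ᵥ v) = 0 :=
    star_dotProduct_eq_zero_of_eigen hN hm hp (by linarith)
  have h2 : star (Xᴴ *ᵥ v) ⬝ᵥ (X *ᵥ v) = 0 :=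
    star_dotProduct_eq_zero_of_eigen hN hp hm (by linarith)
  have hsplit : (X + Xᴴ) *ᵥ v = X *ᵥ v + Xᴴ *ᵥ v := add_mulVec _ _ _
  refine ⟨?_, ?_⟩
  · rw [hsplit, star_add, add_dotProduct, dotProduct_add, dotProduct_add, h1, h2, add_zero, zero_add]
  · rw [hsplit, mulVec_add, hm, hp, star_add, add_dotProduct, dotProduct_add, dotProduct_add,
      dotProduct_smul, dotProduct_smul, dotProduct_smul, dotProduct_smul, h1, h2, smul_zero,
      smul_zero, add_zero, zero_add, smul_eq_mul, smul_eq_mul]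
    push_cast
    ring

variable [DecidableEq m]

/-- **Abstract tower trial-state budget** (Koma–Tasaki Theorem 2.2 'lite', for an exact eigenvector).
Let `H`, `N` be Hermitian, `H₀ ≤ H` as quadratic forms, `X` of charge `-2` (`[N, X] = -2X`),
`O = X + Xᴴ`, and `Φ` a unit vector with `H Φ = e Φ`, `N Φ = n Φ` and `q = ‖OΦ‖² > 0`. If `E` is a
lower bound of `H₀ - μN - hO` on unit vectors then
`h √q ≤ e + ‖[O,[O,H]]‖/(4q) - μ n + |μ| - E`.
Proof: the trial vector `Ξ = Φ + OΦ/√q` has `‖Ξ‖² = 2`, `⟨Ξ,OΞ⟩ = 2√q`, `⟨Ξ,NΞ⟩ ∈ [2n-2, 2n+2]`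
(`OΦ` lives in charges `n ± 2`) and `⟨Ξ,HΞ⟩ = 2e - ⟨Φ,[O,[O,H]]Φ⟩/(2q)` (double-commutator identity
for the eigenvector `Φ`). [cite: KomaTasaki1994, Theorem 2.2] -/
theorem trial_budget {H H₀ N X : Matrix m m ℂ} (hH : H.IsHermitian) (hN : N.IsHermitian)
    (hX : N * X - X * N = ((-2 : ℝ) : ℂ) • X)
    (hHH₀ : ∀ v : m → ℂ, (star v ⬝ᵥ (H₀ *ᵥ v)).re ≤ (star v ⬝ᵥ (H *ᵥ v)).re)
    {Φ : m → ℂ} (hΦ1 : star Φ ⬝ᵥ Φ = 1) {e : ℝ} (hHΦ : H *ᵥ Φ = (e : ℂ) • Φ) {n : ℝ}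
    (hNΦ : N *ᵥ Φ = (n : ℂ) • Φ) {μ h E : ℝ}
    (hE : ∀ φ : m → ℂ, star φ ⬝ᵥ φ = 1 →
      E ≤ (star φ ⬝ᵥ ((H₀ - (μ : ℂ) • N - (h : ℂ) • (X + Xᴴ)) *ᵥ φ)).re)
    (hq : 0 < (star ((X + Xᴴ) *ᵥ Φ) ⬝ᵥ ((X + Xᴴ) *ᵥ Φ)).re) :
    h * Real.sqrt ((star ((X + Xᴴ) *ᵥ Φ) ⬝ᵥ ((X + Xᴴ) *ᵥ Φ)).re) ≤
      e + ‖(X + Xᴴ) * ((X + Xᴴ) * H - H * (X + Xᴴ)) - ((X + Xᴴ) * H - H * (X + Xᴴ)) * (X + Xᴴ)‖ /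
          (4 * (star ((X + Xᴴ) *ᵥ Φ) ⬝ᵥ ((X + Xᴴ) *ᵥ Φ)).re) - μ * n + |μ| - E := by
  obtain ⟨hqsplit, hNΨ⟩ := charged_number_expect hN hX hNΦ
  set O := X + Xᴴ with hO_def
  have hO : O.IsHermitian := Matrix.isHermitian_add_transpose_self X
  set Ψ := O *ᵥ Φ with hΨ
  set D := O * (O * H - H * O) - (O * H - H * O) * O with hD
  set q : ℝ := (star Ψ ⬝ᵥ Ψ).re with hq_def
  set A : ℝ := (star Ψ ⬝ᵥ (H *ᵥ Ψ)).re with hA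
  set B : ℝ := (star Ψ ⬝ᵥ (N *ᵥ Ψ)).re with hB
  -- `q = ‖Ψ‖²` as a complex number
  have hΨΨ : star Ψ ⬝ᵥ Ψ = (q : ℂ) := by
    rw [star_dotProduct_self_eq_eucNorm_sq, hq_def, star_dotProduct_self_eq_eucNorm_sq,
      Complex.ofReal_re]
  have hq_pos : 0 < q := hq
  have hsq : Real.sqrt q ^ 2 = q := Real.sq_sqrt hq_pos.le
  have hsqrt_pos : 0 < Real.sqrt q := Real.sqrt_pos.2 hq_pos
  -- selection rules
  have hV1 : star Φ ⬝ᵥ Ψ = 0 := star_dotProduct_charged_mulVec_eq_zero hN hX hNΦ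
  have hV3 : star Ψ ⬝ᵥ (O *ᵥ Ψ) = 0 := star_charged_mulVec_dotProduct_eq_zero hN hX hNΦ
  have hΨΦ : star Ψ ⬝ᵥ Φ = 0 := by
    rw [hΨ, ← star_dotProduct_mulVec_of_isHermitian hO]; exact hV1
  have hΦOΨ : star Φ ⬝ᵥ (O *ᵥ Ψ) = (q : ℂ) := by
    rw [star_dotProduct_mulVec_of_isHermitian hO, ← hΨ, hΨΨ]
  have hΦHΨ : star Φ ⬝ᵥ (H *ᵥ Ψ) = 0 := by
    rw [star_dotProduct_mulVec_of_isHermitian hH, hHΦ, star_smul, smul_dotProduct, hV1, smul_zero]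
  have hΨHΦ : star Ψ ⬝ᵥ (H *ᵥ Φ) = 0 := by
    rw [hHΦ, dotProduct_smul, hΨΦ, smul_zero]
  have hΦNΨ : star Φ ⬝ᵥ (N *ᵥ Ψ) = 0 := by
    rw [star_dotProduct_mulVec_of_isHermitian hN, hNΦ, star_smul, smul_dotProduct, hV1, smul_zero]
  have hΨNΦ : star Ψ ⬝ᵥ (N *ᵥ Φ) = 0 := by
    rw [hNΦ, dotProduct_smul, hΨΦ, smul_zero]
  -- the trial vector `Ξ = Φ + c Ψ`, `c = 1/√q`
  set c : ℝ := 1 / Real.sqrt q with hc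
  have hcq : c * q = Real.sqrt q := by
    rw [hc]; field_simp; rw [hsq]
  have hc2q : c ^ 2 * q = 1 := by
    rw [hc]; field_simp; rw [hsq]
  set Ξ := Φ + (c : ℂ) • Ψ with hΞ
  have hΞΞ : (star Ξ ⬝ᵥ Ξ).re = 2 := by
    have h1 := star_dotProduct_mulVec_add_smul 1 Φ Ψ c
    simp only [one_mulVec] at h1
    rw [hΞ, h1, hΦ1, hV1, hΨΦ, hΨΨ, mul_zero, add_zero, ← Complex.ofReal_pow, ← Complex.ofReal_mul,
      hc2q]
    norm_num
  have hΞOΞ : (star Ξ ⬝ᵥ (O *ᵥ Ξ)).re = 2 * Real.sqrt q := by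
    rw [hΞ, star_dotProduct_mulVec_add_smul O Φ Ψ c, ← hΨ, hV1, hΦOΨ, hΨΨ, hV3, mul_zero, add_zero,
      zero_add, ← Complex.ofReal_mul, ← Complex.ofReal_add, Complex.ofReal_re, hcq]
    ring
  have hΞHΞ : (star Ξ ⬝ᵥ (H *ᵥ Ξ)).re = e + c ^ 2 * A := by
    rw [hΞ, star_dotProduct_mulVec_add_smul H Φ Ψ c, hΦHΨ, hΨHΦ, mul_zero, add_zero, add_zero,
      Complex.add_re, ← Complex.ofReal_pow, Complex.re_ofReal_mul, hHΦ, dotProduct_smul, hΦ1,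
      smul_eq_mul, mul_one, Complex.ofReal_re]
  have hΞNΞ : (star Ξ ⬝ᵥ (N *ᵥ Ξ)).re = n + c ^ 2 * B := by
    rw [hΞ, star_dotProduct_mulVec_add_smul N Φ Ψ c, hΦNΨ, hΨNΦ, mul_zero, add_zero, add_zero,
      Complex.add_re, ← Complex.ofReal_pow, Complex.re_ofReal_mul, hNΦ, dotProduct_smul, hΦ1,
      smul_eq_mul, mul_one, Complex.ofReal_re]
  -- `A = e q - Re⟨Φ, DΦ⟩/2 ≤ e q + ‖D‖/2`
  have hsand := two_mul_re_sandwich_eq hH hO Φ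
  rw [← hΨ, ← hD] at hsand
  have hOΨHΦ : (star (O *ᵥ Ψ) ⬝ᵥ (H *ᵥ Φ)).re = e * q := by
    rw [hHΦ, dotProduct_smul, ← star_dotProduct_mulVec_of_isHermitian hO, ← hΨ, hΨΨ, smul_eq_mul,
      ← Complex.ofReal_mul, Complex.ofReal_re]
  have hDv : -(star Φ ⬝ᵥ (D *ᵥ Φ)).re ≤ ‖D‖ := by
    have h1 := re_star_dotProduct_mulVec_le (-D) Φ
    rwa [neg_mulVec, dotProduct_neg, Complex.neg_re, norm_neg, eucNorm_eq_one hΦ1, one_pow,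
      mul_one] at h1
  have hP : A ≤ e * q + ‖D‖ / 2 := by rw [hA]; linarith [hsand, hOΨHΦ, hDv]
  -- `|B - n q| ≤ 2 q`
  have hXr : 0 ≤ (star (X *ᵥ Φ) ⬝ᵥ (X *ᵥ Φ)).re := by
    rw [star_dotProduct_self_eq_eucNorm_sq, Complex.ofReal_re]; positivity
  have hXhr : 0 ≤ (star (Xᴴ *ᵥ Φ) ⬝ᵥ (Xᴴ *ᵥ Φ)).re := by
    rw [star_dotProduct_self_eq_eucNorm_sq, Complex.ofReal_re]; positivity
  have hqsum : q = (star (X *ᵥ Φ) ⬝ᵥ (X *ᵥ Φ)).re + (star (Xᴴ *ᵥ Φ) ⬝ᵥ (Xᴴ *ᵥ Φ)).re := by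
    rw [hq_def, hΨ, hO_def, hqsplit, Complex.add_re]
  have hBre : B = (n - 2) * (star (X *ᵥ Φ) ⬝ᵥ (X *ᵥ Φ)).re +
      (n + 2) * (star (Xᴴ *ᵥ Φ) ⬝ᵥ (Xᴴ *ᵥ Φ)).re := by
    rw [hB, hΨ, hO_def, hNΨ, Complex.add_re, Complex.re_ofReal_mul, Complex.re_ofReal_mul]
  have hNlow : -μ * B ≤ -μ * n * q + 2 * |μ| * q := by
    rw [hBre, hqsum]
    rcases le_or_gt 0 μ with hμ | hμ
    · rw [abs_of_nonneg hμ]; nlinarith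
    · rw [abs_of_neg hμ]; nlinarith
  -- variational principle for `K = H₀ - μN - hO` on `Ξ`
  have hvar := mul_re_le_of_unit_bound hE Ξ
  rw [hΞΞ, sub_mulVec, sub_mulVec, smul_mulVec, smul_mulVec, dotProduct_sub, dotProduct_sub,
    dotProduct_smul, dotProduct_smul, smul_eq_mul, smul_eq_mul, Complex.sub_re, Complex.sub_re,
    Complex.re_ofReal_mul, Complex.re_ofReal_mul, hΞOΞ, hΞNΞ] at hvar
  have hH₀Ξ := hHH₀ Ξ
  rw [hΞHΞ] at hH₀Ξ
  -- assemble
  have hstep : c ^ 2 * A ≤ e + 2 * (‖D‖ / (4 * q)) := by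
    have h1 := mul_le_mul_of_nonneg_left hP (sq_nonneg c)
    have hc2 : c ^ 2 = 1 / q := by rw [hc, _root_.one_div_pow, hsq]
    have h2 : c ^ 2 * (e * q + ‖D‖ / 2) = e * (c ^ 2 * q) + 2 * (‖D‖ / (4 * q)) := by
      rw [hc2]; field_simp; ring
    rwa [h2, hc2q, mul_one] at h1
  have hNstep : -μ * (c ^ 2 * B) ≤ -μ * n + 2 * |μ| := by
    have h1 := mul_le_mul_of_nonneg_left hNlow (sq_nonneg c)
    have h2 : c ^ 2 * (-μ * n * q + 2 * |μ| * q) = (-μ * n + 2 * |μ|) * (c ^ 2 * q) := by ring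
    rw [h2, hc2q, mul_one] at h1
    linarith
  linarith [hvar, hH₀Ξ, hstep, hNstep]

end WcbcsTowerTrial

end Summit.HubbardSuperconductivity.HubbardSuperconductivity.Theorems
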